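import Summits.KontsevichZagierPeriods.KontsevichZagierPeriods.Theses.FurushoPentagon
import Summits.KontsevichZagierPeriods.KontsevichZagierPeriods.Theorems.ReducedPeriodRing.Negative.RingForms
import Literature.NumberTheory.Transcendental.KZRulesAssociator
import Literature.NumberTheory.Transcendental.KZProduct
import Mathlib.RingTheory.Ideal.Quotient.Nilpotent
import Mathlib.RingTheory.Localization.Away.Basic

/-!
# Crux triage r1/k3 — checks on the typed "first lemmas" of the five crux ideas for
`ReducedPeriodRing` (stmt-KontsevichZagierPeriods-3929)

All five cards type their transfer as a lemma quantified over an ARBITRARY reduced target ring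
`R` with a multiplicative, move-killing additive map `γ : FormalRep →+ R` plus a kernel-control
hypothesis. This file certifies that, so quantified, the hypotheses are EQUIVALENT to their
conclusions (take `R := P` itself, resp. `R := (P[1/π])_red`): the typed statements are
composition steps, not milestones; the content of every line is the (untyped) PINNING of `R` to a
motivic period algebra (`𝒫̃⁺`, `𝒫̃ = 𝒫̃⁺[1/2πi]`, `colim_D 𝒪(End^⊗_D)`, `𝒪(Iso^⊗_D)`).

* `effectiveTransferExists_iff` : (∃ reduced `R`, faithful multiplicative move-killing `γ`) ↔ crux
  — the shape of `reducedPeriodRing_of_effectiveTransfer` (card effective-period-scheme-…) and of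
  `EffectiveReducedFaithful → … → ReducedPeriodRing` (card effective-end-monoid).
* `localisedTransferExists_iff` : (∃ reduced `R`, multiplicative move-killing `γ` with kernel
  `[π]`-power-torsion mod relations) ↔ `NilIsPiTorsion` — the shape of
  `nilIsPiTorsion_of_localisedTransfer` / `nilpotentsArePiTorsion_of_transfer` (cards
  cartier-localised-…, cartier-pullback-…, kontsevich-coheap-…).
-/

set_option linter.dupNamespace false

namespace Summit.KontsevichZagierPeriods.KontsevichZagierPeriods.Cruxes.ReducedPeriodRing.Triage3

open Literature.NumberTheory.Transcendental KZ
open Summit.KontsevichZagierPeriods.KontsevichZagierPeriods.Theses.FurushoPentagon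
open Summit.KontsevichZagierPeriods.KontsevichZagierPeriods.ReducedPeriodRingNegative

/-! ## 1. Effective transfer, ∃-form -/

/-- The ∃-form of the effective-transfer hypothesis package. -/
def EffectiveTransferExists : Prop :=
  ∃ (R : Type) (_ : CommRing R) (_ : IsReduced R) (γ : FormalRep →+ R),
    (∀ c ∈ relations, γ c = 0) ∧ (∀ a b : FormalRep, γ (a * b) = γ a * γ b) ∧
      (∀ c : FormalRep, γ c = 0 → c ∈ relations)

/-- The cards' composition step. -/
theorem reducedPeriodRing_of_effectiveTransferExists (h : EffectiveTransferExists) :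
    ReducedPeriodRing := by
  obtain ⟨R, _, _, γ, hrel, hmul, hker⟩ := h
  intro c hc
  apply hker
  have h0 : γ c * γ c = 0 := by rw [← hmul]; exact hrel _ hc
  exact IsReduced.eq_zero _ ⟨2, by rw [pow_two]; exact h0⟩

/-- Converse: under the crux, `R := P = FormalRep ⧸ relations` with the quotient map is such a
transfer. Hence the typed ∃-statement is the crux restated. -/
theorem effectiveTransferExists_of_reducedPeriodRing (h : ReducedPeriodRing) :
    EffectiveTransferExists := by
  haveI : IsReduced FormalPeriodRing := reducedPeriodRing_iff_isReduced.mp h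
  refine ⟨FormalPeriodRing, inferInstance, inferInstance,
    (toFormalPeriod : FormalRep →ₙ+* FormalPeriodRing), ?_, ?_, ?_⟩
  · intro c hc
    exact toFormalPeriod_eq_zero_of_mem hc
  · intro a b
    exact map_mul toFormalPeriod a b
  · intro c hc
    exact toFormalPeriod_eq_zero_iff.mp hc

theorem effectiveTransferExists_iff : EffectiveTransferExists ↔ ReducedPeriodRing :=
  ⟨reducedPeriodRing_of_effectiveTransferExists, effectiveTransferExists_of_reducedPeriodRing⟩

/-! ## 2. Localised transfer, ∃-form -/

/-- Cards A/1/2: nilpotents (square-zero classes) are `[π]`-power torsion modulo relations. -/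
def NilIsPiTorsion : Prop :=
  ∀ c : FormalRep, c * c ∈ relations → ∃ N : ℕ, (fun d => of piRep * d)^[N] c ∈ relations

/-- The ∃-form of the localised-transfer hypothesis package. -/
def LocalisedTransferExists : Prop :=
  ∃ (R : Type) (_ : CommRing R) (_ : IsReduced R) (γ : FormalRep →+ R),
    (∀ c ∈ relations, γ c = 0) ∧ (∀ a b : FormalRep, γ (a * b) = γ a * γ b) ∧
      (∀ c : FormalRep, γ c = 0 → ∃ N : ℕ, (fun d => of piRep * d)^[N] c ∈ relations)

/-- The cards' composition step. -/
theorem nilIsPiTorsion_of_localisedTransferExists (h : LocalisedTransferExists) :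
    NilIsPiTorsion := by
  obtain ⟨R, _, _, γ, hrel, hmul, hker⟩ := h
  intro c hc
  apply hker
  have h0 : γ c * γ c = 0 := by rw [← hmul]; exact hrel _ hc
  exact IsReduced.eq_zero _ ⟨2, by rw [pow_two]; exact h0⟩

/-- `⟦[π]^{⋆N} ⋆ c⟧ = t^N · ⟦c⟧` in `P`, `t = ⟦[π]⟧`. -/
theorem toFormalPeriod_iterate (N : ℕ) (c : FormalRep) :
    toFormalPeriod ((fun d => of piRep * d)^[N] c) =
      toFormalPeriod (of piRep) ^ N * toFormalPeriod c := by
  induction N with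
  | zero => simp
  | succ N ih =>
    rw [Function.iterate_succ_apply', map_mul, ih, pow_succ]
    ring

theorem iterate_mem_relations_iff (N : ℕ) (c : FormalRep) :
    (fun d => of piRep * d)^[N] c ∈ relations ↔
      toFormalPeriod (of piRep) ^ N * toFormalPeriod c = 0 := by
  rw [← toFormalPeriod_eq_zero_iff, toFormalPeriod_iterate]

/-- Ring lemma: if square-zero elements are `t`-power torsion then so is every `x` with
`t^N x^(k+1) = 0`. -/
theorem pow_torsion_of_sq {R : Type*} [CommRing R] (t : R)
    (h : ∀ y : R, y * y = 0 → ∃ N : ℕ, t ^ N * y = 0) :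
    ∀ (k : ℕ) (x : R) (N : ℕ), t ^ N * x ^ (k + 1) = 0 → ∃ M : ℕ, t ^ M * x = 0 := by
  intro k
  induction k with
  | zero =>
    intro x N hN
    exact ⟨N, by simpa using hN⟩
  | succ k ih =>
    intro x N hN
    have hy : (t ^ N * x ^ (k + 1)) * (t ^ N * x ^ (k + 1)) = 0 := by
      have : (t ^ N * x ^ (k + 1)) * (t ^ N * x ^ (k + 1)) =
          (t ^ N * x ^ k) * (t ^ N * x ^ (k + 1 + 1)) := by ring
      rw [this, hN, mul_zero]
    obtain ⟨N', hN'⟩ := h _ hy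
    apply ih x (N' + N)
    rw [pow_add, mul_assoc]
    exact hN'

/-- `NilIsPiTorsion` in `P`: square-zero elements of `P` are `t`-power torsion. -/
theorem sq_torsion_of_nilIsPiTorsion (h : NilIsPiTorsion) (y : FormalPeriodRing)
    (hy : y * y = 0) : ∃ N : ℕ, toFormalPeriod (of piRep) ^ N * y = 0 := by
  obtain ⟨c, rfl⟩ := toFormalPeriod_surjective y
  have hc : c * c ∈ relations := by
    rw [← toFormalPeriod_eq_zero_iff, map_mul]; exact hy
  obtain ⟨N, hN⟩ := h c hc
  exact ⟨N, (iterate_mem_relations_iff N c).mp hN⟩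

/-- Converse: under `NilIsPiTorsion`, `R := (P[1/t])_red` with the canonical map is such a
transfer. Hence the typed ∃-statement is `NilIsPiTorsion` restated. -/
theorem localisedTransferExists_of_nilIsPiTorsion (h : NilIsPiTorsion) :
    LocalisedTransferExists := by
  set t : FormalPeriodRing := toFormalPeriod (of piRep) with ht
  let L : Type := Localization.Away t
  let Rred : Type := L ⧸ nilradical L
  haveI : IsReduced Rred :=
    (Ideal.isRadical_iff_quotient_reduced _).mp (Ideal.radical_isRadical (⊥ : Ideal L))
  let γ : FormalRep →+ Rred :=
    ((Ideal.Quotient.mk (nilradical L)).toAddMonoidHom.comp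
      (algebraMap FormalPeriodRing L).toAddMonoidHom).comp
      (toFormalPeriod : FormalRep →ₙ+* FormalPeriodRing)
  have hγ : ∀ c : FormalRep,
      γ c = Ideal.Quotient.mk (nilradical L) (algebraMap FormalPeriodRing L (toFormalPeriod c)) :=
    fun _ => rfl
  refine ⟨Rred, inferInstance, inferInstance, γ, ?_, ?_, ?_⟩
  · intro c hc
    rw [hγ, toFormalPeriod_eq_zero_of_mem hc, map_zero, map_zero]
  · intro a b
    rw [hγ, hγ, hγ, map_mul, map_mul, map_mul]
  · intro c hc
    rw [hγ, Ideal.Quotient.eq_zero_iff_mem, mem_nilradical] at hc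
    obtain ⟨k, hk⟩ := hc
    rw [← map_pow, IsLocalization.map_eq_zero_iff (Submonoid.powers t) L] at hk
    obtain ⟨⟨m, ⟨N, rfl⟩⟩, hm⟩ := hk
    change t ^ N * toFormalPeriod c ^ k = 0 at hm
    -- case on k
    rcases k with _ | k
    · -- t^N = 0: then t^N * x = 0
      refine ⟨N, (iterate_mem_relations_iff N c).mpr ?_⟩
      rw [pow_zero, mul_one] at hm
      rw [← ht, hm, zero_mul]
    · obtain ⟨M, hM⟩ :=
        pow_torsion_of_sq t (sq_torsion_of_nilIsPiTorsion h) k (toFormalPeriod c) N hm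
      exact ⟨M, (iterate_mem_relations_iff M c).mpr (by rw [← ht]; exact hM)⟩

theorem localisedTransferExists_iff : LocalisedTransferExists ↔ NilIsPiTorsion :=
  ⟨nilIsPiTorsion_of_localisedTransferExists, localisedTransferExists_of_nilIsPiTorsion⟩

/-! ## 3. Position of `NilIsPiTorsion` (recorded for the panel; all one-liners)

`crux → NilIsPiTorsion` (N = 0), `PiLocalKernel → NilIsPiTorsion` (nilpotents evaluate to 0),
`NilIsPiTorsion ∧ PiCancellation → crux`. -/

theorem nilIsPiTorsion_of_reducedPeriodRing (h : ReducedPeriodRing) : NilIsPiTorsion :=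
  fun c hc => ⟨0, by simpa using h c hc⟩

theorem nilIsPiTorsion_of_piLocalKernel (h : PiLocalKernel) : NilIsPiTorsion :=
  fun c hc => h c (eval_eq_zero_of_sq_mem_relations hc)

theorem reducedPeriodRing_of_nilIsPiTorsion_of_piCancellation (h1 : NilIsPiTorsion)
    (h2 : PiCancellation) : ReducedPeriodRing := by
  intro c hc
  obtain ⟨N, hN⟩ := h1 c hc
  induction N with
  | zero => simpa using hN
  | succ n ih =>
    apply ih
    rw [Function.iterate_succ_apply'] at hN
    exact h2 _ hN

end Summit.KontsevichZagierPeriods.KontsevichZagierPeriods.Cruxes.ReducedPeriodRing.Triage3
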